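import Summits.HodgeConjecture.CorCM.OcticWeil13PairEightfoldParts
import Summits.HodgeConjecture.CorCM.OcticWeil13PairSixfoldParts
import Summits.HodgeConjecture.CorCM.OcticWeilMixedPowersHodgeOfMarkman
import HarnessLib

/-!
# COR-CM — the Hodge conjecture for EVERY PRODUCT OF COPIES of `E, B, B'₁, B'₂` — the CM curve of `k`, one `(2,2)`-type and
# TWO `(1,3)`-types (split by it) of ONE octic CM field `F ⊇ k` — GIVEN ONLY Markman's fourfold AND hyperbolic-sixfold
# theorems: the FRAME FORM

Cell `pub-hodgecm2` (COR-CM), seat b30 gen 21 (2026-08-22); count-neutral own lane OCTIC-WEIL-EIGHTFOLD — assembly.  Theorems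
only; no definition, no `sorry`; the TWO named facts are DISPLAYED as hypotheses:
`Markman2025_weilClasses_algebraic_abelianFourfold` (`hW4`, the Weil parts of `B`) and
`Markman2025_weilClasses_algebraic_hyperbolicSixfold` (`hM6`, the sixfold parts of `B'₁ × E × E` and `B'₂ × E × E`, and —
through the cell's PUSH-FORWARD EXTRACTION lemma, `CorCM/CMWeightPushforwardExtraction` — the EIGHTFOLD parts of `B'₁ × B̄'₂`).

THE ARGUMENT (Pohlmann + the kernel census `Census/OcticWeil13Pair(Parts)`).  `H^{2p}(X)` of `X = ⨁_j A₄(κ j)` has its Hodge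
classes spanned by the weight lines of the Galois-balanced weights (`Pohlmann1968_thm1_cmAlgebra`); a balanced weight is a
balanced configuration of the model (`modelBalancedP_of_isGaloisBalancedAlg`, the twelve even permutations being realised in
`Aut(ℂ)`), hence a disjoint union of pairs (divisor lines), Weil parts of `B` (Markman's fourfold theorem,
`OcticWeilMixed.weightClassesAlg_le_algebraicClasses_of_isWeil₃Part_slot`), sixfold parts of `B'₁` / `B'₂`
(`weightClassesAlg_le_algebraicClasses_of_isSixfoldPart_one` / `OcticWeilMixed.…_of_isSix₃Part`, Markman's sixfold theorem) and
eightfold parts (`weightClassesAlg_le_algebraicClasses_of_isEightfoldPart`: the sixfold parts of `X⁺ = E⁴ × X`); lines of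
disjoint unions multiply (`PairWeights.weightClassesAlg_union_le_algebraicClasses`).

* `weightClassesAlg_le_algebraicClasses_of_isSixfoldPart` — both `(1,3)`-slots at once, any slot map;
* **`hodgeConjectureFor_biproduct_comp_of_frameP_of_markman`** (every even permutation realised, `hgal`) and
  **`…_of_markman_h2t`** (`2`-transitivity; Dodson: automatic when `B` is simple — the intrinsic forms follow in
  `CorCM/OcticWeil13PairHodgeOfMarkman.lean`).
HONEST FRAMING: `HC_CM` is not asserted; the results are conditional on the two displayed Markman facts and nothing else.
[cite: Markman2025SurveySecant, Thm. 1.2] [cite: Markman2025SecantWeil, Thm 1.5.1] [cite: Pohlmann1968, Thm 1]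
[cite: Milne2020HodgeClassesAV, 1.2 (a) and Thm. 1] [cite: Dodson1984, §3.3.2 Theorem]

## References
* [Markman2025SurveySecant] E. Markman, arXiv:2509.23403, Thm. 1.2, §11.5.  [Markman2025SecantWeil] E. Markman,
  arXiv:2502.03415, Thm 1.5.1.  [Pohlmann1968] Ann. of Math. 88 (1968), Thm 1.  [Milne2020HodgeClassesAV] arXiv:2010.08857,
  1.2 (a), Thm. 1.  [Dodson1984] Trans. AMS 283 (1984), §3.3.2.  [Schoen1998HodgeWeilAddendum] Compositio Math. 114 (1998), §10.
-/

noncomputable section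

open CategoryTheory CategoryTheory.Limits NumberField

namespace Summit.HodgeConjecture.CorCM.OcticWeil13Pair

open Literature.AlgebraicGeometry Literature.AlgebraicGeometry.Motives Literature.AlgebraicGeometry.HodgeTheory
open Literature.AlgebraicGeometry.ComplexMultiplication (IsCMTypeRealisation)
open Literature.AlgebraicGeometry.Pohlmann1968
open Literature.AlgebraicTopology.SingularHomology
open Literature.NumberTheory.ComplexMultiplication
open Summit.HodgeConjecture.CorCM.Census.OcticWeilOrbit (Pt₃ permTab signTab permTab_facts IsPairPart₃ IsWeil₃Part)
open Summit.HodgeConjecture.CorCM.Census.OcticWeilMixed (signTabM signTabM_two)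
open Summit.HodgeConjecture.CorCM.Census.OcticWeil13Pair (signTabP ModelBalancedP IsSixfoldPart IsEightfoldPart
  modelBalancedP_induction)
open Summit.HodgeConjecture.CorCM.OcticWeilOrbit (orbitSlots toPt₃ weightClassesAlg_le_algebraicClasses_of_isPairPart₃
  hgal_of_h2t)
open Summit.HodgeConjecture.CorCM.OcticWeilMixed (typeCount_sixfold_of_frameM weightClassesAlg_le_algebraicClasses_of_isSix₃Part
  weightClassesAlg_le_algebraicClasses_of_isWeil₃Part_slot)
open Summit.HodgeConjecture.CorCM.OcticCurveFourfold
  (weilClassesOf_le_algebraicClasses_cmFourfold_prod_cmCurve_prod_cmCurve_of_markmanSixfold)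
open Summit.HodgeConjecture.CorCM.PairWeights

open scoped Classical Pointwise

section Assembly

variable {I : Type} {Kf : I → Type} [∀ i, Field (Kf i)] [∀ i, NumberField (Kf i)] [∀ i, IsCMField (Kf i)]
  {i₀ i₁ : I} {τ : Kf i₀ →+* ℂ} {e : (Kf i₁ →+* ℂ) ≃ Fin 4 × Bool} {i : Kf i₀ →+* Kf i₁}
  {A₄ : Fin 4 → AbelianVariety ℂ} {Φ₄ : ∀ j : Fin 4, CMType (Kf (orbitSlots i₀ i₁ j))}
  {ι₄ : ∀ j, 𝓞 (Kf (orbitSlots i₀ i₁ j)) →+* End (A₄ j)}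
  {θ₄ : ∀ j, Kf (orbitSlots i₀ i₁ j) →+* Module.End ℂ (complexBetti (A₄ j).X 1)}

/-! ### The `(1,3)`-readings in MIXED form, and the Weil planes of the two sixfolds -/

omit [∀ i, NumberField (Kf i)] [∀ i, IsCMField (Kf i)] in
/-- The slot-`2` reading in MIXED form: `s ∈ Φ₄ 2 ⟺ (e s).2 = signTabM 0 0 2 (e s).1`. [folklore] -/
theorem mem_iff_signTabM_of_frameP_one
    (hΦ : ∀ (m : Fin 3) (s : Kf i₁ →+* ℂ), s ∈ (Φ₄ m.succ).1 ↔ (e s).2 = signTabP 0 m (e s).1) (s : Kf i₁ →+* ℂ) :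
    s ∈ (Φ₄ (1 : Fin 3).succ).1 ↔ (e s).2 = signTabM 0 0 2 (e s).1 := by
  rw [signTabM_two, permTab_facts.2.2]
  exact mem_iff_of_frameP_one hΦ s

omit [∀ i, NumberField (Kf i)] [∀ i, IsCMField (Kf i)] in
/-- The slot-`3` reading in MIXED form: `s ∈ Φ₄ 3 ⟺ (e s).2 = signTabM 2 0 2 (e s).1`. [folklore] -/
theorem mem_iff_signTabM_of_frameP_two
    (hΦ : ∀ (m : Fin 3) (s : Kf i₁ →+* ℂ), s ∈ (Φ₄ m.succ).1 ↔ (e s).2 = signTabP 0 m (e s).1) (s : Kf i₁ →+* ℂ) :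
    s ∈ (Φ₄ (2 : Fin 3).succ).1 ↔ (e s).2 = signTabM 2 0 2 (e s).1 := by
  rw [signTabM_two, permTab_facts.2.2]
  exact mem_iff_of_frameP_two hΦ s

omit [∀ i, IsCMField (Kf i)] in
/-- **Both `(1,3)`-slots: a sixfold part of slot `m ≠ 0` of a weight of ANY product `⨁_j A₄(κ j)` has an algebraic line, GIVEN
the Weil planes of `(B'₁ × E) × E` and `(B'₂ × E) × E`** (slot `1`: this cell's `…_of_isSixfoldPart_one`; slot `2`: gen 20's
`OcticWeilMixed.weightClassesAlg_le_algebraicClasses_of_isSix₃Part`, whose part predicate is definitionally `IsSixfoldPart · 2`).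
[cite: Milne2020HodgeClassesAV, 1.2 (a) and Thm. 1] [cite: Deligne1982HodgeCycles, §5 (c)] -/
theorem weightClassesAlg_le_algebraicClasses_of_isSixfoldPart
    (hk : ∀ σ : Kf i₀ →+* ℂ, σ = τ ∨ σ = ComplexEmbedding.conjugate τ)
    (he_sign : ∀ s : Kf i₁ →+* ℂ, (e s).2 = true ↔ s.comp i = τ)
    (hA : ∀ j, IsCMTypeRealisation (Φ₄ j) (A₄ j) (ι₄ j) (θ₄ j))
    {δ : 𝓞 (Kf i₀)} {d : ℕ} (hτ : τ (δ : Kf i₀) = Complex.I * (Real.sqrt d : ℂ))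
    (hW₂ : weilClassesOf (((A₄ 2).prod (A₄ 0)).prod (A₄ 0))
      (AbelianVariety.prodLift
        (AbelianVariety.fst ((A₄ 2).prod (A₄ 0)) (A₄ 0) ≫
          AbelianVariety.prodLift (AbelianVariety.fst (A₄ 2) (A₄ 0) ≫ ι₄ 2 (RingOfIntegers.mapRingHom i δ))
            (AbelianVariety.snd (A₄ 2) (A₄ 0) ≫ ι₄ 0 δ))
        (AbelianVariety.snd ((A₄ 2).prod (A₄ 0)) (A₄ 0) ≫ ι₄ 0 δ)) 3 d ≤
      algebraicClasses (((A₄ 2).prod (A₄ 0)).prod (A₄ 0)).X 3)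
    (hW₃ : weilClassesOf (((A₄ 3).prod (A₄ 0)).prod (A₄ 0))
      (AbelianVariety.prodLift
        (AbelianVariety.fst ((A₄ 3).prod (A₄ 0)) (A₄ 0) ≫
          AbelianVariety.prodLift (AbelianVariety.fst (A₄ 3) (A₄ 0) ≫ ι₄ 3 (RingOfIntegers.mapRingHom i δ))
            (AbelianVariety.snd (A₄ 3) (A₄ 0) ≫ ι₄ 0 δ))
        (AbelianVariety.snd ((A₄ 3).prod (A₄ 0)) (A₄ 0) ≫ ι₄ 0 δ)) 3 d ≤
      algebraicClasses (((A₄ 3).prod (A₄ 0)).prod (A₄ 0)).X 3)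
    {N : ℕ} (κ : Fin N → Fin 4) {m : Fin 3} (hm : m ≠ 0) {b : Bool}
    {G : Finset ((j : Fin N) × (Kf (orbitSlots i₀ i₁ (κ j)) →+* ℂ))}
    (hG : IsSixfoldPart (fun x => toPt₃ e τ ((Sigma.map κ (fun _ => id) :
      ((j : Fin N) × (Kf (orbitSlots i₀ i₁ (κ j)) →+* ℂ)) → ((l : Fin 4) × (Kf (orbitSlots i₀ i₁ l) →+* ℂ))) x)) m b G) :
    G.card = 2 * 3 ∧ weightClassesAlg (fun j => A₄ (κ j)) (fun j => ι₄ (κ j)) (2 * 3) G ≤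
      algebraicClasses (⨁ fun j => A₄ (κ j)).X 3 := by
  fin_cases m
  · exact absurd rfl hm
  · exact weightClassesAlg_le_algebraicClasses_of_isSixfoldPart_one hk he_sign hA hτ hW₂ κ hG
  · exact weightClassesAlg_le_algebraicClasses_of_isSix₃Part hk he_sign hA hτ hW₃ κ hG

/-! ### Assembly -/

/-- **MAIN THEOREM (frame form).  The Hodge conjecture for every product of copies `⨁_j A₄(κ j)` of `E, B, B'₁, B'₂` — i.e. for
`E^a × B^n × B'₁^{n₁} × B'₂^{n₂}`, all exponents, any order — GIVEN ONLY Markman's fourfold and hyperbolic-sixfold theorems**,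
for `E ⊨ (k; {τ})` (`δ ∈ 𝓞_k`, `δ² = −d`, `τ(δ) = i√d`), `B ⊨ (F; Φ_{I_0})` a `(2,2)`-type and `B'₁ ⊨ (F; Φ'_0)`,
`B'₂ ⊨ (F; Φ'_2)` the `(1,3)`-types with `τ`-member at positions `0 ∈ I_0` and `2 ∉ I_0` of an octic CM field `F ⊇ i(k)`, read in
a frame `e` (`hΦ`), whose conjugate pairs admit every EVEN permutation under `Aut(ℂ)` (`hgal`; Dodson: automatic when `B` is
simple).  Leaves: the two Markman facts ONLY. [cite: Markman2025SurveySecant, Thm. 1.2] [cite: Markman2025SecantWeil, Thm 1.5.1]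
[cite: Pohlmann1968, Thm 1] [cite: Milne2020HodgeClassesAV, 1.2 (a) and Thm. 1] [cite: Dodson1984, §3.3.2 Theorem] -/
theorem hodgeConjectureFor_biproduct_comp_of_frameP_of_markman
    (hW4 : Markman2025_weilClasses_algebraic_abelianFourfold) (hM6 : Markman2025_weilClasses_algebraic_hyperbolicSixfold)
    {N : ℕ} (κ : Fin N → Fin 4) (h8 : Module.finrank ℚ (Kf i₁) = 8) (h2 : Module.finrank ℚ (Kf i₀) = 2) (i : Kf i₀ →+* Kf i₁)
    {δ : 𝓞 (Kf i₀)} {d : ℕ} (hd : 0 < d) (hδ : ((δ : Kf i₀)) ^ 2 = -(d : Kf i₀))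
    (hτ : τ (δ : Kf i₀) = Complex.I * (Real.sqrt d : ℂ))
    (hA : ∀ j, IsCMTypeRealisation (Φ₄ j) (A₄ j) (ι₄ j) (θ₄ j))
    (e : (Kf i₁ →+* ℂ) ≃ Fin 4 × Bool)
    (he_sign : ∀ s : Kf i₁ →+* ℂ, (e s).2 = true ↔ s.comp i = τ)
    (he_conj : ∀ s : Kf i₁ →+* ℂ, e (ComplexEmbedding.conjugate s) = ((e s).1, !(e s).2))
    (hΦ : ∀ (m : Fin 3) (s : Kf i₁ →+* ℂ), s ∈ (Φ₄ m.succ).1 ↔ (e s).2 = signTabP 0 m (e s).1)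
    (hΨ : ∀ σ : Kf i₀ →+* ℂ, σ ∈ (Φ₄ 0).1 ↔ σ = τ)
    (hgal : ∀ r : Fin 12, ∃ ρ : ℂ ≃+* ℂ,
      ∀ a : Fin 4, (ρ : ℂ →+* ℂ).comp (e.symm (a, true)) = e.symm (permTab r a, true)) :
    HodgeConjectureFor (⨁ fun j => A₄ (κ j)).dim (⨁ fun j => A₄ (κ j)).X := by
  have hττ : ComplexEmbedding.conjugate τ ≠ τ := QuarticCM.conjugate_ne τ
  have hk : ∀ σ : Kf i₀ →+* ℂ, σ = τ ∨ σ = ComplexEmbedding.conjugate τ := fun σ =>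
    QuarticCM.eq_or_eq_conjugate_of_quadratic h2 τ σ
  have hcount : ∀ τ' : Kf i₀ →+* ℂ,
      (Finset.univ.filter fun s : Kf i₁ →+* ℂ => s.comp i = τ' ∧ s ∈ (Φ₄ (0 : Fin 3).succ).1).card = 2 :=
    typeCount_eq_two_of_frameP h2 he_sign (mem_iff_of_frameP_zero hΦ)
  -- the Weil planes of `(B'₁ × E) × E` and `(B'₂ × E) × E`, algebraic by Markman's sixfold theorem
  have hW₂ := weilClassesOf_le_algebraicClasses_cmFourfold_prod_cmCurve_prod_cmCurve_of_markmanSixfold hM6 h8 h2 i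
    (hA 2) (hA 0) hd hδ fun τ' => typeCount_sixfold_of_frameM hττ hk he_sign (Φ := Φ₄ 2)
      (mem_iff_signTabM_of_frameP_one hΦ) hΨ τ'
  have hW₃ := weilClassesOf_le_algebraicClasses_cmFourfold_prod_cmCurve_prod_cmCurve_of_markmanSixfold hM6 h8 h2 i
    (hA 3) (hA 0) hd hδ fun τ' => typeCount_sixfold_of_frameM hττ hk he_sign (Φ := Φ₄ 3)
      (mem_iff_signTabM_of_frameP_two hΦ) hΨ τ'
  -- sixfold parts of any product of copies (used on `X` and on `X⁺ = E⁴ × X`)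
  have hsix : ∀ {N' : ℕ} (κ' : Fin N' → Fin 4) (m : Fin 3) (c : Bool)
      (G' : Finset ((j : Fin N') × (Kf (orbitSlots i₀ i₁ (κ' j)) →+* ℂ))), m ≠ 0 →
      IsSixfoldPart (fun x => toPt₃ e τ ((Sigma.map κ' (fun _ => id) :
        ((j : Fin N') × (Kf (orbitSlots i₀ i₁ (κ' j)) →+* ℂ)) → ((l : Fin 4) × (Kf (orbitSlots i₀ i₁ l) →+* ℂ))) x)) m c G' →
      G'.card = 2 * 3 ∧ weightClassesAlg (fun j => A₄ (κ' j)) (fun j => ι₄ (κ' j)) (2 * 3) G' ≤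
        algebraicClasses (⨁ fun j => A₄ (κ' j)).X 3 :=
    fun κ' m c G' hm hG' => weightClassesAlg_le_algebraicClasses_of_isSixfoldPart hk he_sign hA hτ hW₂ hW₃ κ' hm hG'
  refine ⟨nonempty_hodgeModel_holds (Motives.AbelianVariety.isSmoothProjective_holds (A := ⨁ fun j => A₄ (κ j))),
    fun p cl hc hH => ?_⟩
  have hAκ : ∀ j, IsCMTypeRealisation (Φ₄ (κ j)) (A₄ (κ j)) (ι₄ (κ j)) (θ₄ (κ j)) := fun j => hA (κ j)
  -- every balanced configuration has algebraic weight lines: induct over its generating parts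
  have key : ∀ (R : Finset ((j : Fin N) × (Kf (orbitSlots i₀ i₁ (κ j)) →+* ℂ))),
      ModelBalancedP (fun x => toPt₃ e τ ((Sigma.map κ (fun _ => id) :
        ((j : Fin N) × (Kf (orbitSlots i₀ i₁ (κ j)) →+* ℂ)) → ((m : Fin 4) × (Kf (orbitSlots i₀ i₁ m) →+* ℂ))) x)) R →
      ∀ q, R.card = 2 * q → weightClassesAlg (fun j => A₄ (κ j)) (fun j => ι₄ (κ j)) (2 * q) R ≤
        algebraicClasses (⨁ fun j => A₄ (κ j)).X q := by
    intro R hR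
    refine modelBalancedP_induction (motive := fun R => ∀ q, R.card = 2 * q →
      weightClassesAlg (fun j => A₄ (κ j)) (fun j => ι₄ (κ j)) (2 * q) R ≤ algebraicClasses (⨁ fun j => A₄ (κ j)).X q)
      (fun q hq => ?_) (fun G R hGR hG ih q hq => ?_) (fun G R b hGR hG ih q hq => ?_)
      (fun G R m b hm hGR hG ih q hq => ?_) (fun G R b hGR hG ih q hq => ?_) hR
    · obtain rfl : q = 0 := by simpa using hq.symm
      exact fun c' _ => hodgeConjectureFor_codim_zero c'
    · -- a pair part: a divisor line
      obtain ⟨ha, hGalg⟩ := weightClassesAlg_le_algebraicClasses_of_isPairPart₃ κ hττ hk he_conj hA hG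
      have hRcard : R.card = 2 * (q - 1) := by
        have h := Finset.card_union_of_disjoint hGR; rw [hq, ha] at h; omega
      have haq : 1 + (q - 1) = q := by
        have h := Finset.card_union_of_disjoint hGR; rw [hq, ha] at h; omega
      rw [← Finset.disjUnion_eq_union G R hGR]
      exact weightClassesAlg_union_le_algebraicClasses hAκ haq ha hRcard hGR hGalg (ih (q - 1) hRcard)
    · -- a Weil part of `B`: Markman's fourfold theorem
      obtain ⟨ha, hGalg⟩ :=
        weightClassesAlg_le_algebraicClasses_of_isWeil₃Part_slot κ hW4 h8 h2 hττ hk he_sign hA hcount hG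
      have hRcard : R.card = 2 * (q - 2) := by
        have h := Finset.card_union_of_disjoint hGR; rw [hq, ha] at h; omega
      have haq : 2 + (q - 2) = q := by
        have h := Finset.card_union_of_disjoint hGR; rw [hq, ha] at h; omega
      rw [← Finset.disjUnion_eq_union G R hGR]
      exact weightClassesAlg_union_le_algebraicClasses hAκ haq ha hRcard hGR hGalg (ih (q - 2) hRcard)
    · -- a sixfold part of `B'₁` or `B'₂`: Markman's sixfold theorem
      obtain ⟨ha, hGalg⟩ := hsix κ m b G hm hG
      have hRcard : R.card = 2 * (q - 3) := by
        have h := Finset.card_union_of_disjoint hGR; rw [hq, ha] at h; omega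
      have haq : 3 + (q - 3) = q := by
        have h := Finset.card_union_of_disjoint hGR; rw [hq, ha] at h; omega
      rw [← Finset.disjUnion_eq_union G R hGR]
      exact weightClassesAlg_union_le_algebraicClasses hAκ haq ha hRcard hGR hGalg (ih (q - 3) hRcard)
    · -- an eightfold part of `B'₁ × B̄'₂`: push-pull through `E⁴ × X`, the sixfold parts there
      obtain ⟨ha, hGalg⟩ := weightClassesAlg_le_algebraicClasses_of_isEightfoldPart κ hττ hk he_conj hA
        (fun m c G' hm hG' => (hsix (ext₄ κ) m c G' hm hG').2) hG
      have hRcard : R.card = 2 * (q - 4) := by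
        have h := Finset.card_union_of_disjoint hGR; rw [hq, ha] at h; omega
      have haq : 4 + (q - 4) = q := by
        have h := Finset.card_union_of_disjoint hGR; rw [hq, ha] at h; omega
      rw [← Finset.disjUnion_eq_union G R hGR]
      exact weightClassesAlg_union_le_algebraicClasses hAκ haq ha hRcard hGR hGalg (ih (q - 4) hRcard)
  have hmem : cl ∈ ⨆ S ∈ pohlmannSetsAlg (K := fun j => Kf (orbitSlots i₀ i₁ (κ j))) (fun j => Φ₄ (κ j)) p,
      weightClassesAlg (fun j => A₄ (κ j)) (fun j => ι₄ (κ j)) (2 * p) S := by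
    rw [← (Pohlmann1968_thm1_cmAlgebra (fun j => Kf (orbitSlots i₀ i₁ (κ j))) (fun j => A₄ (κ j))
      (fun j => Φ₄ (κ j)) (fun j => ι₄ (κ j)) (fun j => θ₄ (κ j)) hAκ p).1]
    exact Submodule.subset_span ⟨hc, hH⟩
  have hle : (⨆ S ∈ pohlmannSetsAlg (K := fun j => Kf (orbitSlots i₀ i₁ (κ j))) (fun j => Φ₄ (κ j)) p,
      weightClassesAlg (fun j => A₄ (κ j)) (fun j => ι₄ (κ j)) (2 * p) S) ≤
      algebraicClasses (⨁ fun j => A₄ (κ j)).X p := by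
    refine iSup₂_le fun S hS => ?_
    exact key S (modelBalancedP_of_isGaloisBalancedAlg hττ hk he_sign he_conj hΦ hΨ κ hgal hS.2) p hS.1
  exact hle hmem

omit [∀ i, NumberField (Kf i)] [∀ i, IsCMField (Kf i)] in
/-- **No Weil parts of `B` without `B`**: if the slot map avoids the atom slot `1`, no Weil part of model slot `0` occurs.
[folklore] -/
theorem not_isWeil₃Part_zero_of_ne_one {N : ℕ} (κ : Fin N → Fin 4) (hκ : ∀ j, κ j ≠ 1) {b : Bool}
    {G : Finset ((j : Fin N) × (Kf (orbitSlots i₀ i₁ (κ j)) →+* ℂ))}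
    (hG : IsWeil₃Part (fun x => toPt₃ e τ ((Sigma.map κ (fun _ => id) :
      ((j : Fin N) × (Kf (orbitSlots i₀ i₁ (κ j)) →+* ℂ)) → ((l : Fin 4) × (Kf (orbitSlots i₀ i₁ l) →+* ℂ))) x)) 0 b G) :
    False := by
  obtain ⟨x, hx⟩ := hG.nonempty
  obtain ⟨a, ha⟩ := hG.exists_eq_inr hx
  change toPt₃ e τ ⟨κ x.1, x.2⟩ = _ at ha
  rcases OcticWeilOrbit.sigma_cases₃ (⟨κ x.1, x.2⟩ : (l : Fin 4) × (Kf (orbitSlots i₀ i₁ l) →+* ℂ)) with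
    ⟨σ, hσ⟩ | ⟨m, s', hs⟩
  · rw [hσ, OcticWeilOrbit.toPt₃_zero] at ha; exact Sum.inl_ne_inr ha
  · rw [hs, OcticWeilOrbit.toPt₃_succ, Sum.inr.injEq, Prod.mk.injEq] at ha
    have h1 := congrArg Sigma.fst hs
    change κ x.1 = m.succ at h1
    rw [ha.1] at h1
    exact hκ x.1 h1

/-- **WITHOUT `B`: the frame form for products of copies of `E, B'₁, B'₂` ALONE (slot maps avoiding the atom slot `1`), GIVEN
ONLY Markman's hyperbolic-SIXFOLD theorem** — no Weil part of `B` occurs (`not_isWeil₃Part_zero_of_ne_one`), so the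
fourfold theorem is not needed; the `(2,2)`-type `Φ₄ 1` and its realisation only fix the frame.
[cite: Markman2025SecantWeil, Thm 1.5.1] [cite: Pohlmann1968, Thm 1] [cite: Milne2020HodgeClassesAV, 1.2 (a) and Thm. 1] -/
theorem hodgeConjectureFor_biproduct_comp_of_frameP_of_markmanSixfold
    (hM6 : Markman2025_weilClasses_algebraic_hyperbolicSixfold)
    {N : ℕ} (κ : Fin N → Fin 4) (hκ : ∀ j, κ j ≠ 1) (h8 : Module.finrank ℚ (Kf i₁) = 8) (h2 : Module.finrank ℚ (Kf i₀) = 2)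
    (i : Kf i₀ →+* Kf i₁)
    {δ : 𝓞 (Kf i₀)} {d : ℕ} (hd : 0 < d) (hδ : ((δ : Kf i₀)) ^ 2 = -(d : Kf i₀))
    (hτ : τ (δ : Kf i₀) = Complex.I * (Real.sqrt d : ℂ))
    (hA : ∀ j, IsCMTypeRealisation (Φ₄ j) (A₄ j) (ι₄ j) (θ₄ j))
    (e : (Kf i₁ →+* ℂ) ≃ Fin 4 × Bool)
    (he_sign : ∀ s : Kf i₁ →+* ℂ, (e s).2 = true ↔ s.comp i = τ)
    (he_conj : ∀ s : Kf i₁ →+* ℂ, e (ComplexEmbedding.conjugate s) = ((e s).1, !(e s).2))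
    (hΦ : ∀ (m : Fin 3) (s : Kf i₁ →+* ℂ), s ∈ (Φ₄ m.succ).1 ↔ (e s).2 = signTabP 0 m (e s).1)
    (hΨ : ∀ σ : Kf i₀ →+* ℂ, σ ∈ (Φ₄ 0).1 ↔ σ = τ)
    (hgal : ∀ r : Fin 12, ∃ ρ : ℂ ≃+* ℂ,
      ∀ a : Fin 4, (ρ : ℂ →+* ℂ).comp (e.symm (a, true)) = e.symm (permTab r a, true)) :
    HodgeConjectureFor (⨁ fun j => A₄ (κ j)).dim (⨁ fun j => A₄ (κ j)).X := by
  have hττ : ComplexEmbedding.conjugate τ ≠ τ := QuarticCM.conjugate_ne τ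
  have hk : ∀ σ : Kf i₀ →+* ℂ, σ = τ ∨ σ = ComplexEmbedding.conjugate τ := fun σ =>
    QuarticCM.eq_or_eq_conjugate_of_quadratic h2 τ σ
  have hW₂ := weilClassesOf_le_algebraicClasses_cmFourfold_prod_cmCurve_prod_cmCurve_of_markmanSixfold hM6 h8 h2 i
    (hA 2) (hA 0) hd hδ fun τ' => typeCount_sixfold_of_frameM hττ hk he_sign (Φ := Φ₄ 2)
      (mem_iff_signTabM_of_frameP_one hΦ) hΨ τ'
  have hW₃ := weilClassesOf_le_algebraicClasses_cmFourfold_prod_cmCurve_prod_cmCurve_of_markmanSixfold hM6 h8 h2 i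
    (hA 3) (hA 0) hd hδ fun τ' => typeCount_sixfold_of_frameM hττ hk he_sign (Φ := Φ₄ 3)
      (mem_iff_signTabM_of_frameP_two hΦ) hΨ τ'
  have hsix : ∀ {N' : ℕ} (κ' : Fin N' → Fin 4) (m : Fin 3) (c : Bool)
      (G' : Finset ((j : Fin N') × (Kf (orbitSlots i₀ i₁ (κ' j)) →+* ℂ))), m ≠ 0 →
      IsSixfoldPart (fun x => toPt₃ e τ ((Sigma.map κ' (fun _ => id) :
        ((j : Fin N') × (Kf (orbitSlots i₀ i₁ (κ' j)) →+* ℂ)) → ((l : Fin 4) × (Kf (orbitSlots i₀ i₁ l) →+* ℂ))) x)) m c G' →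
      G'.card = 2 * 3 ∧ weightClassesAlg (fun j => A₄ (κ' j)) (fun j => ι₄ (κ' j)) (2 * 3) G' ≤
        algebraicClasses (⨁ fun j => A₄ (κ' j)).X 3 :=
    fun κ' m c G' hm hG' => weightClassesAlg_le_algebraicClasses_of_isSixfoldPart hk he_sign hA hτ hW₂ hW₃ κ' hm hG'
  refine ⟨nonempty_hodgeModel_holds (Motives.AbelianVariety.isSmoothProjective_holds (A := ⨁ fun j => A₄ (κ j))),
    fun p cl hc hH => ?_⟩
  have hAκ : ∀ j, IsCMTypeRealisation (Φ₄ (κ j)) (A₄ (κ j)) (ι₄ (κ j)) (θ₄ (κ j)) := fun j => hA (κ j)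
  have key : ∀ (R : Finset ((j : Fin N) × (Kf (orbitSlots i₀ i₁ (κ j)) →+* ℂ))),
      ModelBalancedP (fun x => toPt₃ e τ ((Sigma.map κ (fun _ => id) :
        ((j : Fin N) × (Kf (orbitSlots i₀ i₁ (κ j)) →+* ℂ)) → ((m : Fin 4) × (Kf (orbitSlots i₀ i₁ m) →+* ℂ))) x)) R →
      ∀ q, R.card = 2 * q → weightClassesAlg (fun j => A₄ (κ j)) (fun j => ι₄ (κ j)) (2 * q) R ≤
        algebraicClasses (⨁ fun j => A₄ (κ j)).X q := by
    intro R hR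
    refine modelBalancedP_induction (motive := fun R => ∀ q, R.card = 2 * q →
      weightClassesAlg (fun j => A₄ (κ j)) (fun j => ι₄ (κ j)) (2 * q) R ≤ algebraicClasses (⨁ fun j => A₄ (κ j)).X q)
      (fun q hq => ?_) (fun G R hGR hG ih q hq => ?_) (fun G R b hGR hG ih q hq => ?_)
      (fun G R m b hm hGR hG ih q hq => ?_) (fun G R b hGR hG ih q hq => ?_) hR
    · obtain rfl : q = 0 := by simpa using hq.symm
      exact fun c' _ => hodgeConjectureFor_codim_zero c'
    · obtain ⟨ha, hGalg⟩ := weightClassesAlg_le_algebraicClasses_of_isPairPart₃ κ hττ hk he_conj hA hG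
      have hRcard : R.card = 2 * (q - 1) := by
        have h := Finset.card_union_of_disjoint hGR; rw [hq, ha] at h; omega
      have haq : 1 + (q - 1) = q := by
        have h := Finset.card_union_of_disjoint hGR; rw [hq, ha] at h; omega
      rw [← Finset.disjUnion_eq_union G R hGR]
      exact weightClassesAlg_union_le_algebraicClasses hAκ haq ha hRcard hGR hGalg (ih (q - 1) hRcard)
    · exact (not_isWeil₃Part_zero_of_ne_one κ hκ hG).elim
    · obtain ⟨ha, hGalg⟩ := hsix κ m b G hm hG
      have hRcard : R.card = 2 * (q - 3) := by
        have h := Finset.card_union_of_disjoint hGR; rw [hq, ha] at h; omega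
      have haq : 3 + (q - 3) = q := by
        have h := Finset.card_union_of_disjoint hGR; rw [hq, ha] at h; omega
      rw [← Finset.disjUnion_eq_union G R hGR]
      exact weightClassesAlg_union_le_algebraicClasses hAκ haq ha hRcard hGR hGalg (ih (q - 3) hRcard)
    · obtain ⟨ha, hGalg⟩ := weightClassesAlg_le_algebraicClasses_of_isEightfoldPart κ hττ hk he_conj hA
        (fun m c G' hm hG' => (hsix (ext₄ κ) m c G' hm hG').2) hG
      have hRcard : R.card = 2 * (q - 4) := by
        have h := Finset.card_union_of_disjoint hGR; rw [hq, ha] at h; omega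
      have haq : 4 + (q - 4) = q := by
        have h := Finset.card_union_of_disjoint hGR; rw [hq, ha] at h; omega
      rw [← Finset.disjUnion_eq_union G R hGR]
      exact weightClassesAlg_union_le_algebraicClasses hAκ haq ha hRcard hGR hGalg (ih (q - 4) hRcard)
  have hmem : cl ∈ ⨆ S ∈ pohlmannSetsAlg (K := fun j => Kf (orbitSlots i₀ i₁ (κ j))) (fun j => Φ₄ (κ j)) p,
      weightClassesAlg (fun j => A₄ (κ j)) (fun j => ι₄ (κ j)) (2 * p) S := by
    rw [← (Pohlmann1968_thm1_cmAlgebra (fun j => Kf (orbitSlots i₀ i₁ (κ j))) (fun j => A₄ (κ j))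
      (fun j => Φ₄ (κ j)) (fun j => ι₄ (κ j)) (fun j => θ₄ (κ j)) hAκ p).1]
    exact Submodule.subset_span ⟨hc, hH⟩
  have hle : (⨆ S ∈ pohlmannSetsAlg (K := fun j => Kf (orbitSlots i₀ i₁ (κ j))) (fun j => Φ₄ (κ j)) p,
      weightClassesAlg (fun j => A₄ (κ j)) (fun j => ι₄ (κ j)) (2 * p) S) ≤
      algebraicClasses (⨁ fun j => A₄ (κ j)).X p := by
    refine iSup₂_le fun S hS => ?_
    exact key S (modelBalancedP_of_isGaloisBalancedAlg hττ hk he_sign he_conj hΦ hΨ κ hgal hS.2) p hS.1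
  exact hle hmem

/-- **The frame form under `2`-TRANSITIVITY** (`h2t`; Dodson: automatic when `B` is simple): the twelve even permutations are
realised by `OcticWeilOrbit.hgal_of_h2t`. [cite: Markman2025SurveySecant, Thm. 1.2] [cite: Markman2025SecantWeil, Thm 1.5.1]
[cite: Dodson1984, §3.3.2 Theorem] -/
theorem hodgeConjectureFor_biproduct_comp_of_frameP_of_markman_h2t
    (hW4 : Markman2025_weilClasses_algebraic_abelianFourfold) (hM6 : Markman2025_weilClasses_algebraic_hyperbolicSixfold)
    {N : ℕ} (κ : Fin N → Fin 4) (h8 : Module.finrank ℚ (Kf i₁) = 8) (h2 : Module.finrank ℚ (Kf i₀) = 2) (i : Kf i₀ →+* Kf i₁)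
    {δ : 𝓞 (Kf i₀)} {d : ℕ} (hd : 0 < d) (hδ : ((δ : Kf i₀)) ^ 2 = -(d : Kf i₀))
    (hτ : τ (δ : Kf i₀) = Complex.I * (Real.sqrt d : ℂ))
    (hA : ∀ j, IsCMTypeRealisation (Φ₄ j) (A₄ j) (ι₄ j) (θ₄ j))
    (e : (Kf i₁ →+* ℂ) ≃ Fin 4 × Bool)
    (he_sign : ∀ s : Kf i₁ →+* ℂ, (e s).2 = true ↔ s.comp i = τ)
    (he_conj : ∀ s : Kf i₁ →+* ℂ, e (ComplexEmbedding.conjugate s) = ((e s).1, !(e s).2))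
    (hΦ : ∀ (m : Fin 3) (s : Kf i₁ →+* ℂ), s ∈ (Φ₄ m.succ).1 ↔ (e s).2 = signTabP 0 m (e s).1)
    (hΨ : ∀ σ : Kf i₀ →+* ℂ, σ ∈ (Φ₄ 0).1 ↔ σ = τ)
    (h2t : ∀ a b : Fin 4, a ≠ b → ∃ ρ : ℂ ≃+* ℂ,
      (ρ : ℂ →+* ℂ).comp (e.symm (a, true)) = e.symm (0, true) ∧ (ρ : ℂ →+* ℂ).comp (e.symm (b, true)) = e.symm (1, true)) :
    HodgeConjectureFor (⨁ fun j => A₄ (κ j)).dim (⨁ fun j => A₄ (κ j)).X :=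
  hodgeConjectureFor_biproduct_comp_of_frameP_of_markman hW4 hM6 κ h8 h2 i hd hδ hτ hA e he_sign he_conj hΦ hΨ
    (hgal_of_h2t he_sign h2t)

end Assembly

end Summit.HodgeConjecture.CorCM.OcticWeil13Pair

end
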